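/-
Copyright (c) 2026 the pub-hodgecm-mathlib formalisation cell (harness21).  Prover seat hodgecm-mathlib-K2Liu-p06 (g4), Track B «K2-LIT»,
#184♮ = hLiu418 = `stmt-HodgeConjecture-24832`; #42S payer road, organ S1 (local Siegel–Weil spanning), ROAD W file F3c-B3 (geometry of the big cell:
continuity of `t ↦ n(t)` and of `g ↦ B(g)`; the CONTRACTING choice of the Levi scalar = the `hcontr` binder of ★ F3b `spanning_criterion`; «M-157t», «M-158a»).
-/
import Summits.HodgeConjecture.HodgeConjecture.Theorems.K2LiuLocalSWBigCellTopology   -- ★ F3c-B1 `continuous_adapt_matA_map_eval` (+ F3c-A)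
import Summits.HodgeConjecture.HodgeConjecture.Theorems.K2LiuLocalSWLeviScalars       -- ★ F3c-B2 `exists_leviScalar`
import Literature.NumberTheory.GaloisRepresentations.AdicCompletionUniformizer            -- ★ `nontriviallyNormedField` on `F_v` (punctured neighbourhoods are non-trivial)
import Summits.HodgeConjecture.HodgeConjecture.Theorems.K2LiuUnipDeltaLocalCoordinates -- ★ `skew_blkB_of_mem_unipDeltaLocal`, `eq_nElem_of_mem_unipDeltaLocal`, `nElem_zero'`
import Summits.HodgeConjecture.HodgeConjecture.Theorems.K2LiuUnipDeltaRankOneHaar      -- ★ `continuous_matA`, `continuous_blkB_matA`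
import Summits.HodgeConjecture.HodgeConjecture.Theorems.K2LiuSkewPairingNondegeneracy -- ★ `smul_skew`
import HarnessLib

/-!
# Crux `HLiu418`, #42S organ S1, ROAD W, file F3c-B3: THE CONTRACTING LEVI SCALARS (the `hcontr` binder of ★ `spanning_criterion`)

Cell `hodgecm-mathlib`, crux item hLiu418 = `stmt-HodgeConjecture-24832`; squad K2 ∕ K2Liu; prover K2Liu-p06 (g4), the dedicated S1 hand.
THEOREMS ONLY (no `def`, no instance, no notation, no named-fact hypothesis, no `sorry`); lane `--supports stmt-HodgeConjecture-24832 --as helper`.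

★ F3b `spanning_criterion` asks, for the compact-open coordinate lattice `N₁ = {u ∈ N_Δ : B(u) ∈ Λ}` of the witness and EVERY open subgroup `V ≤ H_v`, for
elements `m, p_m` with `w_Δ m = p_m w_Δ`, `m^{±1} N_Δ m^{∓1} ⊆ N_Δ`, `m N₁ m⁻¹ ⊆ V`, and `m N₁ m⁻¹ ∩ N_Δ` open in `N_Δ`.  With the Levi scalars of ★ F3c-B2
(`m(a) u m(a)⁻¹` has coordinate `a²·B(u)`) this is the statement that `a² · Λ` shrinks into the `B`-coordinates of `V` as `a → 0` — a tube-lemma argument over the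
compact `Λ ∩ {skew}` for the continuous map `(a, t) ↦ n(a² t)` (§1: `t ↦ n(t)` is continuous on the skew matrices, via ★ `coe_ofAdapted_apply`, `Units.continuous_iff`
and `n(t)⁻¹ = n(−t)`; `g ↦ B(g)` is continuous by ★ `K2LiuUnipDeltaRankOneHaar.continuous_blkB_matA`; `u = n(B(u))` on `N_Δ` by
★ `K2LiuUnipDeltaLocalCoordinates.eq_nElem_of_mem_unipDeltaLocal`), plus `a ≠ 0` near `0` in the non-discrete field `F_v` (★ `AdicCompletion.nontriviallyNormedField`).
* §1 `continuous_nElem` (on the subtype of `T₀`-skew matrices, every `n`; the tree had the rank-one `continuous_nElem_coord`).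
* §2 `continuous_nElem_sq_smul`, `exists_open_zero_nElem_sq_smul_mem` (tube-lemma step), `exists_ne_zero_mem_of_isOpen`, and **`exists_contracting`** — the `hcontr`
  binder of ★ `spanning_criterion`, for `N₁` given by a compact open coordinate box `Λ ∋ 0` (hypothesis `hN₁`), in GR91 local currency (`P_Δ`-membership as
  ★ `IsSiegelDelta`; the K2Liu CM assembly converts with ★ `mem_siegelDeltaLoc_iff_local`).
References: [BernsteinZelevinsky1976] §1.5; [Kudla1994] §3; [HarrisKudlaSweet1996] §1 (1.11).
HONEST LABEL.  Count-neutral helper: `HC_CM` is proved only modulo the 7 printed citations (2 remaining named inputs: hLiu418 = `stmt-HodgeConjecture-24832`,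
h413 = `stmt-HodgeConjecture-24833`) until rung 0 closes.
-/

set_option autoImplicit false
set_option linter.dupNamespace false -- the mandated namespace repeats `HodgeConjecture.HodgeConjecture`

noncomputable section

open NumberField IsDedekindDomain Matrix
open Literature.NumberTheory.Automorphic Literature.NumberTheory.Automorphic.UnitaryGroup
open Literature.NumberTheory.GelbartRogawski1991.AdaptedBlocks
open Literature.NumberTheory.GelbartRogawski1991.UnitaryDualPair.LocalSplitting
open Literature.NumberTheory.K2Lit.LocalSiegelDoubled
open Summit.HodgeConjecture.HodgeConjecture.Cruxes.HLiu418.K2LiuLocalSWBigCellDecomposition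
open Summit.HodgeConjecture.HodgeConjecture.Cruxes.HLiu418.K2LiuLocalSWBigCellTopology
open Summit.HodgeConjecture.HodgeConjecture.Cruxes.HLiu418.K2LiuLocalSWLeviScalars
open Summit.HodgeConjecture.HodgeConjecture.Cruxes.HLiu418.K2LiuUnipDeltaLocalCoordinates
open Summit.HodgeConjecture.HodgeConjecture.Cruxes.HLiu418.K2LiuUnipDeltaRankOneHaar
open Summit.HodgeConjecture.HodgeConjecture.Cruxes.HLiu418.K2LiuSkewPairingNondegeneracy

namespace Summit.HodgeConjecture.HodgeConjecture.Cruxes.HLiu418.K2LiuLocalSWBigCellContraction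

variable (F : Type) [Field F] [NumberField F] (E : Type) [Field E] [NumberField E] [Algebra F E]
  (c : E ≃ₐ[F] E)
  {δ : E} (hcδ : c δ = -δ) (hδ : δ ≠ 0) {d : F} (hd : δ * δ = algebraMap F E d)
  (v : HeightOneSpectrum (𝓞 F)) (n : ℕ) {T₀ : Matrix (Fin n) (Fin n) F} (hT₀ : T₀.IsSymm) (hT₀d : IsUnit T₀.det)
  {JD : Matrix (Fin (n + n)) (Fin (n + n)) E} (hJD : JD = (gramD F n T₀).map (algebraMap F E))

/-! ## §1 Continuity of `t ↦ n(t)` -/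

/-- the `w`-component of the matrix of ★ `ofAdapted Y` depends continuously on `Y`. [cite: MoeglinVignerasWaldspurger1987, Chap. 2 II.8] -/
theorem continuous_coe_ofAdapted_comp {X : Type*} [TopologicalSpace X] (Y : X → Matrix (Fin n ⊕ Fin n) (Fin n ⊕ Fin n) (LocalRing E v))
    (hY : Continuous Y) (hYu : ∀ x, IsUnit (Y x).det)
    (hYf : ∀ x, ((Y x).map (conjLocal E c v))ᵀ * adForm F E v n (T₀ := T₀) * Y x = adForm F E v n (T₀ := T₀)) (w : PlacesOver E v) :
    Continuous fun x => (((ofAdapted F E c v n hJD (Y x) (hYu x) (hYf x) : UnitaryGroup.LocalGLPi E (n + n) v) w :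
      GL (Fin (n + n)) (w.1.adicCompletion E)) : Matrix (Fin (n + n)) (Fin (n + n)) (w.1.adicCompletion E)) := by
  simp only [coe_ofAdapted_apply]
  refine (continuous_const.mul ?_).mul continuous_const
  have h1 : Continuous fun x => Matrix.reindex (e₂ n) (e₂ n) (Y x) := hY.matrix_submatrix _ _
  exact continuous_matrix fun i j => (continuous_apply w).comp ((continuous_apply j).comp ((continuous_apply i).comp h1))

include hJD in
/-- the `w`-component of the matrix of `n(t)`: `(R · [[1, t], [0, 1]] · R⁻¹)_w`, re-enumerated (★ `coe_component_eq_matS_map`, ★ `matA_ofAdapted`).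
[cite: Kudla1994, §3] -/
theorem coe_nElem_component (w : PlacesOver E v) (t : Matrix (Fin n) (Fin n) (LocalRing E v))
    (ht : (t.map (conjLocal E c v))ᵀ * gramS F E v n T₀ + gramS F E v n T₀ * t = 0) :
    ((((nElem F E c v n hJD t ht : UnitaryGroup.localPi E c (n + n) JD v) : UnitaryGroup.LocalGLPi E (n + n) v) w :
        GL (Fin (n + n)) (w.1.adicCompletion E)) : Matrix (Fin (n + n)) (Fin (n + n)) (w.1.adicCompletion E)) =
      (Matrix.reindex (e₂ n) (e₂ n) (cayR (LocalRing E v) (Fin n) * Matrix.fromBlocks 1 t 0 1 * cayRinv (LocalRing E v) (Fin n))).map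
        (Pi.evalRingHom (fun w' : PlacesOver E v => w'.1.adicCompletion E) w) := by
  rw [coe_component_eq_matS_map, ← reindex_matA, nElem, matA_ofAdapted]

include hJD in
/-- **`t ↦ n(t)` is continuous** on the `T₀`-skew matrices (values in `H(F_v) ≤ Π_w GL_{2n}(E_w)`; the inverse `n(t)⁻¹ = n(−t)` is handled by ★ `nElem_inv`).
[cite: MoeglinVignerasWaldspurger1987, Chap. 2 II.8] [cite: BernsteinZelevinsky1976, §1.5] -/
theorem continuous_nElem :
    Continuous fun t : {t : Matrix (Fin n) (Fin n) (LocalRing E v) // (t.map (conjLocal E c v))ᵀ * gramS F E v n T₀ + gramS F E v n T₀ * t = 0} =>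
      nElem F E c v n hJD t.1 t.2 := by
  have hmat : ∀ s : {t : Matrix (Fin n) (Fin n) (LocalRing E v) // (t.map (conjLocal E c v))ᵀ * gramS F E v n T₀ + gramS F E v n T₀ * t = 0} → Matrix (Fin n) (Fin n) (LocalRing E v),
      Continuous s → ∀ w : PlacesOver E v, Continuous fun t =>
        (Matrix.reindex (e₂ n) (e₂ n) (cayR (LocalRing E v) (Fin n) * Matrix.fromBlocks 1 (s t) 0 1 * cayRinv (LocalRing E v) (Fin n))).map
          (Pi.evalRingHom (fun w' : PlacesOver E v => w'.1.adicCompletion E) w) := by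
    intro s hs w
    have h1 : Continuous fun t => cayR (LocalRing E v) (Fin n) * Matrix.fromBlocks 1 (s t) 0 1 * cayRinv (LocalRing E v) (Fin n) :=
      (continuous_const.mul (continuous_const.matrix_fromBlocks hs continuous_const continuous_const)).mul continuous_const
    have h2 := h1.matrix_submatrix (e₂ n).symm (e₂ n).symm
    exact continuous_matrix fun i j => (continuous_apply w).comp ((continuous_apply j).comp ((continuous_apply i).comp h2))
  have hval : Continuous fun t : {t : Matrix (Fin n) (Fin n) (LocalRing E v) // (t.map (conjLocal E c v))ᵀ * gramS F E v n T₀ + gramS F E v n T₀ * t = 0} =>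
      ((nElem F E c v n hJD t.1 t.2 : UnitaryGroup.localPi E c (n + n) JD v) : UnitaryGroup.LocalGLPi E (n + n) v) := by
    refine continuous_pi fun w => Units.continuous_iff.2 ⟨?_, ?_⟩
    · exact (hmat (fun t => t.1) continuous_subtype_val w).congr fun t => (coe_nElem_component F E c v n hJD w t.1 t.2).symm
    · refine (hmat (fun t => -t.1) continuous_subtype_val.neg w).congr fun t => ?_
      rw [← coe_nElem_component F E c v n hJD w (-t.1) (skew_neg F E c v n t.2), ← nElem_inv, Subgroup.coe_inv, Pi.inv_apply]
  exact continuous_induced_rng.2 hval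

/-! ## §2 The contracting Levi scalar: the `hcontr` binder of ★ `spanning_criterion` -/

include hJD in
/-- `n(t) = 1` when `t = 0`. [cite: Kudla1994, §3] -/
theorem nElem_eq_one_of_eq_zero {t : Matrix (Fin n) (Fin n) (LocalRing E v)}
    (ht : (t.map (conjLocal E c v))ᵀ * gramS F E v n T₀ + gramS F E v n T₀ * t = 0) (h : t = 0) :
    nElem F E c v n hJD t ht = 1 := by
  subst h
  exact nElem_zero' F E c v n hJD

include hJD in
/-- The two-variable deformation `(a, t) ↦ n(a² t)` on `F_v × skew` is continuous. [cite: Kudla1994, §3] -/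
theorem continuous_nElem_sq_smul :
    Continuous fun q : v.adicCompletion F × {t : Matrix (Fin n) (Fin n) (LocalRing E v) //
        (t.map (conjLocal E c v))ᵀ * gramS F E v n T₀ + gramS F E v n T₀ * t = 0} =>
      nElem F E c v n hJD ((toLocalRing E v (q.1 * q.1)) • q.2.1) (smul_skew F E c v (q.1 * q.1) q.2.2) := by
  have hin : Continuous fun q : v.adicCompletion F × {t : Matrix (Fin n) (Fin n) (LocalRing E v) //
      (t.map (conjLocal E c v))ᵀ * gramS F E v n T₀ + gramS F E v n T₀ * t = 0} =>
      (⟨(toLocalRing E v (q.1 * q.1)) • q.2.1, smul_skew F E c v (q.1 * q.1) q.2.2⟩ :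
        {t : Matrix (Fin n) (Fin n) (LocalRing E v) // (t.map (conjLocal E c v))ᵀ * gramS F E v n T₀ + gramS F E v n T₀ * t = 0}) :=
    Continuous.subtype_mk ((((continuous_toLocalRing E v).comp (continuous_fst.mul continuous_fst))).smul
      (continuous_subtype_val.comp continuous_snd)) _
  have hcomp := (continuous_nElem F E c v n hJD).comp hin
  exact hcomp

include hJD in
/-- **Tube-lemma step**: for a compact box `Λ` of matrices and an open `U ∋ 1` of `H_v` there is an open `A ∋ 0` of `F_v` with `n(a² t) ∈ U` for all `a ∈ A` and all
skew `t ∈ Λ` (continuity of `(a, t) ↦ n(a² t)`, `n(0) = 1`, and the generalized tube lemma over `{0} × (Λ ∩ skew)`). [cite: BernsteinZelevinsky1976, §1.5] [cite: Kudla1994, §3] -/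
theorem exists_open_zero_nElem_sq_smul_mem {Λ : Set (Matrix (Fin n) (Fin n) (LocalRing E v))} (hΛc : IsCompact Λ)
    {U : Set (UnitaryGroup.localPi E c (n + n) JD v)} (hU : IsOpen U) (h1 : (1 : UnitaryGroup.localPi E c (n + n) JD v) ∈ U) :
    ∃ A : Set (v.adicCompletion F), IsOpen A ∧ (0 : v.adicCompletion F) ∈ A ∧
      ∀ a ∈ A, ∀ (t : Matrix (Fin n) (Fin n) (LocalRing E v)) (ht : (t.map (conjLocal E c v))ᵀ * gramS F E v n T₀ + gramS F E v n T₀ * t = 0), t ∈ Λ →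
        nElem F E c v n hJD ((toLocalRing E v (a * a)) • t) (smul_skew F E c v (a * a) ht) ∈ U := by
  have h𝔰c : IsClosed {t : Matrix (Fin n) (Fin n) (LocalRing E v) | (t.map (conjLocal E c v))ᵀ * gramS F E v n T₀ + gramS F E v n T₀ * t = 0} :=
    isClosed_eq (((continuous_id.matrix_map (continuous_conjLocal E c v)).matrix_transpose.mul continuous_const).add
      (continuous_const.mul continuous_id)) continuous_const
  have hKc : IsCompact (Subtype.val ⁻¹' Λ : Set {t : Matrix (Fin n) (Fin n) (LocalRing E v) //
      (t.map (conjLocal E c v))ᵀ * gramS F E v n T₀ + gramS F E v n T₀ * t = 0}) :=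
    h𝔰c.isClosedEmbedding_subtypeVal.isCompact_preimage hΛc
  have hsub : ({0} : Set (v.adicCompletion F)) ×ˢ (Subtype.val ⁻¹' Λ : Set {t : Matrix (Fin n) (Fin n) (LocalRing E v) //
      (t.map (conjLocal E c v))ᵀ * gramS F E v n T₀ + gramS F E v n T₀ * t = 0}) ⊆
      (fun q : v.adicCompletion F × {t : Matrix (Fin n) (Fin n) (LocalRing E v) //
          (t.map (conjLocal E c v))ᵀ * gramS F E v n T₀ + gramS F E v n T₀ * t = 0} =>
        nElem F E c v n hJD ((toLocalRing E v (q.1 * q.1)) • q.2.1) (smul_skew F E c v (q.1 * q.1) q.2.2)) ⁻¹' U := by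
    rintro ⟨a, t⟩ ⟨ha, -⟩
    have ha0 : a = 0 := ha
    subst ha0
    rw [Set.mem_preimage, nElem_eq_one_of_eq_zero F E c v n hJD _ (by rw [mul_zero, map_zero, zero_smul])]
    exact h1
  obtain ⟨A, B, hAo, -, hA0, hKB, hAB⟩ :=
    generalized_tube_lemma isCompact_singleton hKc (hU.preimage (continuous_nElem_sq_smul F E c v n hJD)) hsub
  refine ⟨A, hAo, hA0 (Set.mem_singleton 0), fun a haA t ht htΛ => ?_⟩
  have hmem := hAB (Set.mk_mem_prod haA (hKB (show (⟨t, ht⟩ : {t : Matrix (Fin n) (Fin n) (LocalRing E v) //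
    (t.map (conjLocal E c v))ᵀ * gramS F E v n T₀ + gramS F E v n T₀ * t = 0}) ∈ Subtype.val ⁻¹' Λ from htΛ)))
  exact hmem

/-- Punctured neighbourhoods of `0` in `F_v` are non-empty (`F_v` is a NON-trivially normed field). [folklore] -/
theorem exists_ne_zero_mem_of_isOpen {A : Set (v.adicCompletion F)} (hA : IsOpen A) (h0 : (0 : v.adicCompletion F) ∈ A) :
    ∃ a ∈ A, a ≠ 0 := by
  letI := Literature.NumberTheory.GaloisRepresentations.Ultrametric.AdicCompletion.nontriviallyNormedField F v
  have hA' : A ∈ nhdsWithin (0 : v.adicCompletion F) {0}ᶜ := mem_nhdsWithin_of_mem_nhds (hA.mem_nhds h0)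
  obtain ⟨a, haA, ha0⟩ := Filter.nonempty_of_mem (Filter.inter_mem hA' self_mem_nhdsWithin)
  exact ⟨a, haA, ha0⟩

include hJD in
/-- `n(a² · a⁻² B(u)) = u` for `u ∈ N_Δ` and `a ≠ 0`. [cite: Kudla1994, §3] -/
theorem nElem_sq_smul_invSq_smul_blkB {a : v.adicCompletion F} (ha : a ≠ 0) {u : UnitaryGroup.localPi E c (n + n) JD v}
    (hu : u ∈ unipDeltaLocal F E c v n (JD := JD))
    (hskew : (((toLocalRing E v a⁻¹ * toLocalRing E v a⁻¹) • blkB (matA F E c v n u)).map (conjLocal E c v))ᵀ * gramS F E v n T₀ +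
        gramS F E v n T₀ * ((toLocalRing E v a⁻¹ * toLocalRing E v a⁻¹) • blkB (matA F E c v n u)) = 0) :
    nElem F E c v n hJD ((toLocalRing E v (a * a)) • ((toLocalRing E v a⁻¹ * toLocalRing E v a⁻¹) • blkB (matA F E c v n u)))
      (smul_skew F E c v (a * a) hskew) = u := by
  refine Eq.trans ?_ (eq_nElem_of_mem_unipDeltaLocal F E c v n hJD hu).symm
  refine matA_injective F E c v n (eq_of_adapt_eq ?_)
  rw [adapt_matA_nElem, adapt_matA_nElem, smul_smul, ← map_mul, ← map_mul,
    show a * a * (a⁻¹ * a⁻¹) = 1 by field_simp, map_one, one_smul]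

include hcδ hδ hd hT₀ in
/-- **THE CONTRACTING LEVI SCALAR** — the `hcontr` binder of ★ F3b `spanning_criterion` for the local doubled unitary group: for the coordinate lattice
`N₁ = {u ∈ N_Δ : B(u) ∈ Λ}` of a compact open box `Λ ∋ 0` of matrices and EVERY open subgroup `V ≤ H_v`, there are `m` and `p_m ∈ P_Δ` with `w_Δ m = p_m w_Δ`,
`m^{±1} N_Δ m^{∓1} ⊆ N_Δ`, `{u ∈ N_Δ : m⁻¹ u m ∈ N₁} ⊆ V`, and an open `O ∋ 1` with `O ∩ N_Δ ⊆ {x : m⁻¹ x m ∈ N₁}`.  Proof: `m = m(a)` (★ F3c-B2) with `a ≠ 0` small,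
found by the tube lemma for `(a, t) ↦ n(a² t)` over `{0} × (Λ ∩ skew)` and the non-triviality of punctured neighbourhoods in `F_v`.
[cite: BernsteinZelevinsky1976, §1.5] [cite: Kudla1994, §3] [cite: HarrisKudlaSweet1996, §1 (1.11)] -/
theorem exists_contracting [Algebra.IsQuadraticExtension F E]
    {Λ : Set (Matrix (Fin n) (Fin n) (LocalRing E v))} (hΛc : IsCompact Λ) (hΛo : IsOpen Λ) (h0 : (0 : Matrix (Fin n) (Fin n) (LocalRing E v)) ∈ Λ)
    {N₁ : Subgroup (UnitaryGroup.localPi E c (n + n) JD v)}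
    (hN₁ : ∀ u, u ∈ N₁ ↔ u ∈ unipDeltaLocal F E c v n (JD := JD) ∧ blkB (matA F E c v n u) ∈ Λ)
    (V : Subgroup (UnitaryGroup.localPi E c (n + n) JD v)) (hV : IsOpen (V : Set (UnitaryGroup.localPi E c (n + n) JD v))) :
    ∃ m pm : UnitaryGroup.localPi E c (n + n) JD v, IsSiegelDelta F E c hcδ hδ hd v n hT₀ hJD pm ∧
      weylDelta F E c v n hJD * m = pm * weylDelta F E c v n hJD ∧
      (∀ x ∈ unipDeltaLocal F E c v n (JD := JD), m * x * m⁻¹ ∈ unipDeltaLocal F E c v n (JD := JD)) ∧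
      (∀ x ∈ unipDeltaLocal F E c v n (JD := JD), m⁻¹ * x * m ∈ unipDeltaLocal F E c v n (JD := JD)) ∧
      (∀ u ∈ unipDeltaLocal F E c v n (JD := JD), m⁻¹ * u * m ∈ N₁ → u ∈ V) ∧
      ∃ O : Set (UnitaryGroup.localPi E c (n + n) JD v), IsOpen O ∧ (1 : UnitaryGroup.localPi E c (n + n) JD v) ∈ O ∧
        ∀ x ∈ O, x ∈ unipDeltaLocal F E c v n (JD := JD) → m⁻¹ * x * m ∈ N₁ := by
  -- a small NON-ZERO scalar `a` with `n(a² t) ∈ V` for all skew `t ∈ Λ`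
  obtain ⟨A, hAo, hA0, hA⟩ := exists_open_zero_nElem_sq_smul_mem F E c v n hJD hΛc hV V.one_mem
  obtain ⟨a, haA, ha0⟩ := exists_ne_zero_mem_of_isOpen F v hAo hA0
  -- the Levi scalar `m = m(a)` and its inverse `p_m = m(a)⁻¹ ∈ P_Δ`
  obtain ⟨m, m', -, hm', -, hwm, hconj, hconj'⟩ := exists_leviScalar F E c hcδ hδ hd v n hT₀ hJD (JD := JD) ha0
  refine ⟨m, m', hm', hwm, fun x hx => (hconj x hx).1, fun x hx => (hconj' x hx).1, fun u hu hu1 => ?_, ?_⟩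
  · -- `m⁻¹ u m ∈ N₁ ⇒ u = n(a² · a⁻² B(u)) ∈ V`
    obtain ⟨-, hB⟩ := (hN₁ _).1 hu1
    rw [(hconj' u hu).2] at hB
    have hskew : (((toLocalRing E v a⁻¹ * toLocalRing E v a⁻¹) • blkB (matA F E c v n u)).map (conjLocal E c v))ᵀ * gramS F E v n T₀ +
        gramS F E v n T₀ * ((toLocalRing E v a⁻¹ * toLocalRing E v a⁻¹) • blkB (matA F E c v n u)) = 0 := by
      rw [← map_mul]
      exact smul_skew F E c v _ (skew_blkB_of_mem_unipDeltaLocal F E c v n hJD hu)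
    have hmem := hA a haA _ hskew hB
    rw [nElem_sq_smul_invSq_smul_blkB F E c v n hJD ha0 hu hskew] at hmem
    exact hmem
  · -- the open `O = {x : a⁻² B(x) ∈ Λ}`
    have hc : Continuous fun x : UnitaryGroup.localPi E c (n + n) JD v => (toLocalRing E v a⁻¹ * toLocalRing E v a⁻¹) • blkB (matA F E c v n x) :=
      (continuous_blkB_matA F E c v n (JD := JD)).const_smul (toLocalRing E v a⁻¹ * toLocalRing E v a⁻¹)
    refine ⟨(fun x : UnitaryGroup.localPi E c (n + n) JD v => (toLocalRing E v a⁻¹ * toLocalRing E v a⁻¹) • blkB (matA F E c v n x)) ⁻¹' Λ,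
      hΛo.preimage hc, ?_, fun x hx hxN => ?_⟩
    · rw [Set.mem_preimage, matA_one, blkB_one, smul_zero]
      exact h0
    · rw [Set.mem_preimage] at hx
      rw [hN₁]
      exact ⟨(hconj' x hxN).1, by rw [(hconj' x hxN).2]; exact hx⟩

end Summit.HodgeConjecture.HodgeConjecture.Cruxes.HLiu418.K2LiuLocalSWBigCellContraction

end
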